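import Mathlib.Order.Zorn
import Mathlib.Topology.Connected.Clopen
import Mathlib.Topology.Algebra.OpenSubgroup
import Mathlib.Analysis.Matrix.Normed
import Mathlib.Analysis.Complex.Polynomial.Basic
import Literature.Analysis.Calculus.ClosedSubgroupExpChart
import Literature.NumberTheory.Automorphic.TorusCharacters
import HarnessLib

/-!
# Maximal connected commutative subgroups of a compact matrix group; generic elements

Topic `RepresentationTheory/CompactGroups`. The "compact Lie" half of the proof that a compact
connected linear group has an element with abelian centraliser (`ExistsAbelianCentralizer`),
resting on von Neumann's exponential chart for closed linear groups (tree
`Literature.Analysis.Calculus.exists_exp_chart_range`). All proved, no definitions: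

* `exists_maximal_connected_comm_subgroup` — in any topological group, every subgroup `H` contains
  a subgroup `A ≤ H` maximal among the connected commutative ones (Zorn: a chain has the union as
  upper bound);
* `exists_ball_subset_of_maximal` — **the centraliser of a maximal connected commutative `A` in a
  compact `H ≤ GL_N(ℂ)` coincides with `A` near `1`**: an element `k ∈ Z_H(A)` close to `1` lies on
  a one-parameter subgroup `exp(ℝX)` of `Z_H(A)` (exponential chart), and `A · exp(ℝX)` is a
  connected commutative subgroup of `H` containing `A`, hence equal to `A`;
* `exists_finset_smul_cover_of_maximal` — consequently `Z_H(A)` is covered by finitely many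
  translates `f · A` (compactness);
* `exists_generic_mem` — a connected commutative group `A ≤ GL n ℂ` of semisimple elements contains
  a *generic* element `t`: every matrix commuting with `t` commutes with all of `A` (simultaneous
  diagonalisation; the finitely many closed subgroups `{χ_i = χ_j}` of `A` defined by distinct
  diagonal characters are nowhere dense, since an open subgroup of a connected group is
  everything).

Sources: J. von Neumann, Math. Z. 30 (1929) (the chart); T. Bröcker, T. tom Dieck, *Representations
of Compact Lie Groups* (1985), IV §1–§2; A. L. Onishchik, E. B. Vinberg (1990), Ch. 5 §2.
-/

noncomputable section

open scoped Pointwise Topology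
open NormedSpace

namespace Literature.RepresentationTheory.CompactGroups

open Literature.NumberTheory.Automorphic

/-! ### Maximal connected commutative subgroups (Zorn) -/

/-- **Maximal connected commutative subgroups exist**: every subgroup `H` of a topological group
contains a subgroup `A ≤ H` which is connected and commutative and maximal with these properties.
[folklore] -/
theorem exists_maximal_connected_comm_subgroup {G : Type*} [Group G] [TopologicalSpace G]
    (H : Subgroup G) :
    ∃ A : Subgroup G, A ≤ H ∧ IsConnected (A : Set G) ∧ (∀ a ∈ A, ∀ b ∈ A, a * b = b * a) ∧
      ∀ B : Subgroup G, B ≤ H → IsConnected (B : Set G) → (∀ a ∈ B, ∀ b ∈ B, a * b = b * a) →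
        A ≤ B → B = A := by
  let S : Set (Subgroup G) :=
    {B | B ≤ H ∧ IsPreconnected (B : Set G) ∧ ∀ a ∈ B, ∀ b ∈ B, a * b = b * a}
  have hbot : (⊥ : Subgroup G) ∈ S := by
    refine ⟨bot_le, ?_, ?_⟩
    · rw [Subgroup.coe_bot]; exact isPreconnected_singleton
    · intro a ha b hb
      rw [Subgroup.mem_bot] at ha hb
      simp [ha, hb]
  -- chains are bounded: the union of a chain of connected commutative subgroups is one
  have ih : ∀ c ⊆ S, IsChain (· ≤ ·) c → ∀ y ∈ c, ∃ ub ∈ S, ∀ z ∈ c, z ≤ ub := by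
    intro c hcS hc y hy
    have hne : c.Nonempty := ⟨y, hy⟩
    have hdir : DirectedOn (· ≤ ·) c := hc.directedOn
    refine ⟨sSup c, ⟨sSup_le fun B hB => (hcS hB).1, ?_, ?_⟩, fun z hz => le_sSup hz⟩
    · have hset : ((sSup c : Subgroup G) : Set G) =
          ⋃₀ ((fun B : Subgroup G => (B : Set G)) '' c) := by
        ext x
        simp only [SetLike.mem_coe, Subgroup.mem_sSup_of_directedOn hne hdir, Set.sUnion_image,
          Set.mem_iUnion, exists_prop]
      rw [hset]
      refine isPreconnected_sUnion 1 _ ?_ ?_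
      · rintro _ ⟨B, -, rfl⟩; exact B.one_mem
      · rintro _ ⟨B, hB, rfl⟩; exact (hcS hB).2.1
    · intro a ha b hb
      rw [Subgroup.mem_sSup_of_directedOn hne hdir] at ha hb
      obtain ⟨B₁, h₁, ha⟩ := ha
      obtain ⟨B₂, h₂, hb⟩ := hb
      rcases hc.total h₁ h₂ with h12 | h21
      · exact (hcS h₂).2.2 a (h12 ha) b hb
      · exact (hcS h₁).2.2 a ha b (h21 hb)
  obtain ⟨A, -, hA⟩ := zorn_le_nonempty₀ S ih ⊥ hbot
  refine ⟨A, hA.prop.1, ⟨⟨1, A.one_mem⟩, hA.prop.2.1⟩, hA.prop.2.2,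
    fun B hBH hBc hBcomm hAB => ?_⟩
  exact le_antisymm (hA.le_of_ge ⟨hBH, hBc.isPreconnected, hBcomm⟩ hAB) hAB

/-! ### The centraliser of a maximal connected commutative subgroup near the identity -/

section MatrixGroup

open scoped Matrix.Norms.Frobenius

variable {N : ℕ}

/-- The centraliser subgroup `Z_H(A) = H ⊓ centralizer A` is closed when `H` is. [folklore] -/
theorem isClosed_inf_centralizer {H A : Subgroup (GL (Fin N) ℂ)} (hH : IsClosed (H : Set (GL (Fin N) ℂ))) :
    IsClosed ((H ⊓ Subgroup.centralizer (A : Set (GL (Fin N) ℂ)) : Subgroup (GL (Fin N) ℂ)) :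
      Set (GL (Fin N) ℂ)) := by
  have : ((H ⊓ Subgroup.centralizer (A : Set (GL (Fin N) ℂ)) : Subgroup (GL (Fin N) ℂ)) :
      Set (GL (Fin N) ℂ)) = (H : Set (GL (Fin N) ℂ)) ∩ ⋂ a ∈ A, {g | a * g = g * a} := by
    ext g
    simp [Subgroup.mem_centralizer_iff]
  rw [this]
  exact hH.inter (isClosed_biInter fun a _ =>
    isClosed_eq (continuous_const.mul continuous_id) (continuous_id.mul continuous_const))

/-- **Near `1`, the centraliser of a maximal connected commutative subgroup is the subgroup
itself.** Let `H ≤ GL_N(ℂ)` be compact and `A ≤ H` connected, commutative and maximal with these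
properties. Then there is `r > 0` such that every `k ∈ H` commuting with `A` and with
`‖k - 1‖ < r` (Frobenius norm) belongs to `A`. Proof: by the exponential chart of the compact
group `Z_H(A)`, `k = exp X` with `exp(ℝX) ⊆ Z_H(A)`; then `{a · exp(tX)}` is a connected commutative
subgroup of `H` containing `A`, so it is `A`, and `k = exp(1·X) ∈ A`. [folklore] -/
theorem exists_ball_subset_of_maximal {H A : Subgroup (GL (Fin N) ℂ)}
    (hHc : IsCompact (H : Set (GL (Fin N) ℂ))) (hAH : A ≤ H)
    (hAconn : IsConnected (A : Set (GL (Fin N) ℂ))) (hAcomm : ∀ a ∈ A, ∀ b ∈ A, a * b = b * a)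
    (hmax : ∀ B : Subgroup (GL (Fin N) ℂ), B ≤ H → IsConnected (B : Set (GL (Fin N) ℂ)) →
      (∀ a ∈ B, ∀ b ∈ B, a * b = b * a) → A ≤ B → B = A) :
    ∃ r : ℝ, 0 < r ∧ ∀ k ∈ H ⊓ Subgroup.centralizer (A : Set (GL (Fin N) ℂ)),
      ‖(k : Matrix (Fin N) (Fin N) ℂ) - 1‖ < r → k ∈ A := by
  set K : Subgroup (GL (Fin N) ℂ) := H ⊓ Subgroup.centralizer (A : Set (GL (Fin N) ℂ)) with hKdef
  have hKc : IsCompact (K : Set (GL (Fin N) ℂ)) :=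
    hHc.of_isClosed_subset (isClosed_inf_centralizer hHc.isClosed) fun _ hk => hk.1
  haveI : CompactSpace K := isCompact_iff_compactSpace.mp hKc
  -- the exponential chart of the compact matrix group `K`
  let ρ : K →* Matrix (Fin N) (Fin N) ℂ := (Units.coeHom _).comp K.subtype
  have hρ : Continuous ρ := Units.continuous_val.comp continuous_subtype_val
  have hρapply : ∀ k : K, ρ k = ((k : GL (Fin N) ℂ) : Matrix (Fin N) (Fin N) ℂ) := fun k => rfl
  obtain ⟨r, hr, hchart⟩ := Literature.Analysis.Calculus.exists_exp_chart_range ρ hρ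
  refine ⟨r, hr, fun k hk hkr => ?_⟩
  obtain ⟨X, hXK, hXk, -⟩ := hchart ⟨k, hk⟩ (by simpa [hρapply] using hkr)
  -- the one-parameter subgroup `γ(t) = exp(tX)` inside `K`
  choose γ' hγ' using hXK
  let γ : ℝ → GL (Fin N) ℂ := fun t => (γ' t : GL (Fin N) ℂ)
  have hγval : ∀ t, ((γ t : GL (Fin N) ℂ) : Matrix (Fin N) (Fin N) ℂ) = exp (t • X) := fun t => hγ' t
  have hγK : ∀ t, γ t ∈ K := fun t => (γ' t).2
  have hγadd : ∀ s t, γ (s + t) = γ s * γ t := by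
    intro s t
    refine Units.ext ?_
    rw [Units.val_mul, hγval, hγval, hγval, add_smul]
    exact exp_add_of_commute (((Commute.refl X).smul_left s).smul_right t)
  have hγzero : γ 0 = 1 := Units.ext (by rw [hγval, zero_smul, exp_zero, Units.val_one])
  have hγneg : ∀ t, γ (-t) = (γ t)⁻¹ := fun t =>
    eq_inv_of_mul_eq_one_right (by rw [← hγadd, add_neg_cancel, hγzero])
  have hγcont : Continuous γ := by
    refine Units.continuous_iff.2 ⟨?_, ?_⟩
    · have : (Units.val ∘ γ) = fun t => exp (t • X) := funext hγval
      rw [this]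
      exact exp_continuous.comp (continuous_id.smul continuous_const)
    · have : (fun t => ((γ t)⁻¹ : GL (Fin N) ℂ).val) = fun t => exp ((-t) • X) := by
        funext t; rw [← hγneg, hγval]
      rw [this]
      exact exp_continuous.comp (continuous_neg.smul continuous_const)
  have hγcomm : ∀ t, ∀ a ∈ A, a * γ t = γ t * a := fun t a ha =>
    (Subgroup.mem_centralizer_iff.1 (hγK t).2) a ha
  have hprod : ∀ a b (s t : ℝ), b ∈ A → a * γ s * (b * γ t) = a * b * γ (s + t) := by
    intro a b s t hb
    calc a * γ s * (b * γ t) = a * (γ s * b) * γ t := by simp only [mul_assoc]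
      _ = a * (b * γ s) * γ t := by rw [hγcomm s b hb]
      _ = a * b * γ (s + t) := by rw [hγadd]; simp only [mul_assoc]
  -- the subgroup `B = A · γ(ℝ)`
  let B : Subgroup (GL (Fin N) ℂ) :=
    { carrier := {x | ∃ a ∈ A, ∃ t : ℝ, x = a * γ t}
      one_mem' := ⟨1, A.one_mem, 0, by rw [hγzero, mul_one]⟩
      mul_mem' := by
        rintro _ _ ⟨a, ha, s, rfl⟩ ⟨b, hb, t, rfl⟩
        exact ⟨a * b, A.mul_mem ha hb, s + t, hprod a b s t hb⟩
      inv_mem' := by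
        rintro _ ⟨a, ha, t, rfl⟩
        refine ⟨a⁻¹, A.inv_mem ha, -t, ?_⟩
        have hc : Commute a⁻¹ (γ t) := hγcomm t a⁻¹ (A.inv_mem ha)
        rw [mul_inv_rev, hγneg, hc.inv_right.eq] }
  have hmemB : ∀ x, x ∈ B ↔ ∃ a ∈ A, ∃ t : ℝ, x = a * γ t := fun x => Iff.rfl
  have hAB : A ≤ B := fun a ha => (hmemB a).2 ⟨a, ha, 0, by rw [hγzero, mul_one]⟩
  have hBH : B ≤ H := by
    intro x hx
    obtain ⟨a, ha, t, rfl⟩ := (hmemB x).1 hx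
    exact H.mul_mem (hAH ha) (hγK t).1
  have hBcomm : ∀ x ∈ B, ∀ y ∈ B, x * y = y * x := by
    intro x hx y hy
    obtain ⟨a, ha, s, rfl⟩ := (hmemB x).1 hx
    obtain ⟨b, hb, t, rfl⟩ := (hmemB y).1 hy
    rw [hprod a b s t hb, hprod b a t s ha, hAcomm a ha b hb, add_comm]
  have hBconn : IsConnected (B : Set (GL (Fin N) ℂ)) := by
    have hset : (B : Set (GL (Fin N) ℂ)) =
        (fun p : GL (Fin N) ℂ × ℝ => p.1 * γ p.2) '' ((A : Set (GL (Fin N) ℂ)) ×ˢ Set.univ) := by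
      ext x
      constructor
      · intro hx
        obtain ⟨a, ha, t, rfl⟩ := (hmemB x).1 hx
        exact ⟨(a, t), ⟨ha, Set.mem_univ _⟩, rfl⟩
      · rintro ⟨⟨a, t⟩, ⟨ha, -⟩, rfl⟩
        exact (hmemB _).2 ⟨a, ha, t, rfl⟩
    rw [hset]
    exact (hAconn.prod isConnected_univ).image _
      (continuous_fst.mul (hγcont.comp continuous_snd)).continuousOn
  have hBA : B = A := hmax B hBH hBconn hBcomm hAB
  -- `k = γ(1) ∈ B = A`
  have hk1 : k = γ 1 := Units.ext (by rw [hγval, one_smul, hXk]; rfl)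
  rw [hk1, ← hBA, hmemB]
  exact ⟨1, A.one_mem, 1, by rw [one_mul]⟩

/-- **Finitely many translates of a maximal connected commutative subgroup cover its
centraliser** in a compact `H ≤ GL_N(ℂ)`: with `r` as in `exists_ball_subset_of_maximal`, the open
sets `k · {‖g - 1‖ < r}`, `k ∈ Z_H(A)`, cover the compact `Z_H(A)`; a finite subcover gives
`Z_H(A) ⊆ ⋃_{f ∈ F} f · A`. [folklore] -/
theorem exists_finset_smul_cover_of_maximal {H A : Subgroup (GL (Fin N) ℂ)}
    (hHc : IsCompact (H : Set (GL (Fin N) ℂ))) (hAH : A ≤ H)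
    (hAconn : IsConnected (A : Set (GL (Fin N) ℂ))) (hAcomm : ∀ a ∈ A, ∀ b ∈ A, a * b = b * a)
    (hmax : ∀ B : Subgroup (GL (Fin N) ℂ), B ≤ H → IsConnected (B : Set (GL (Fin N) ℂ)) →
      (∀ a ∈ B, ∀ b ∈ B, a * b = b * a) → A ≤ B → B = A) :
    ∃ F : Finset (GL (Fin N) ℂ), (∀ f ∈ F, f ∈ H ⊓ Subgroup.centralizer (A : Set (GL (Fin N) ℂ))) ∧
      ∀ k ∈ H ⊓ Subgroup.centralizer (A : Set (GL (Fin N) ℂ)),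
        ∃ f ∈ F, k ∈ f • (A : Set (GL (Fin N) ℂ)) := by
  classical
  obtain ⟨r, hr, hball⟩ := exists_ball_subset_of_maximal hHc hAH hAconn hAcomm hmax
  set K : Subgroup (GL (Fin N) ℂ) := H ⊓ Subgroup.centralizer (A : Set (GL (Fin N) ℂ)) with hKdef
  have hKc : IsCompact (K : Set (GL (Fin N) ℂ)) :=
    hHc.of_isClosed_subset (isClosed_inf_centralizer hHc.isClosed) fun _ hk => hk.1
  set V : Set (GL (Fin N) ℂ) := {g | ‖(g : Matrix (Fin N) (Fin N) ℂ) - 1‖ < r} with hVdef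
  have hVopen : IsOpen V :=
    isOpen_lt (continuous_norm.comp (Units.continuous_val.sub continuous_const)) continuous_const
  have h1V : (1 : GL (Fin N) ℂ) ∈ V := by simp [hVdef, hr]
  obtain ⟨t, ht⟩ := hKc.elim_finite_subcover (fun k : K => (k : GL (Fin N) ℂ) • V)
    (fun k => hVopen.smul _) fun g hg => Set.mem_iUnion.2 ⟨⟨g, hg⟩, ⟨1, h1V, mul_one g⟩⟩
  refine ⟨t.image (fun k : K => (k : GL (Fin N) ℂ)), ?_, fun k hk => ?_⟩
  · intro f hf
    obtain ⟨k₀, -, rfl⟩ := Finset.mem_image.1 hf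
    exact k₀.2
  · obtain ⟨k₀, hk₀t, hkk₀⟩ : ∃ k₀ ∈ t, k ∈ (k₀ : GL (Fin N) ℂ) • V := by
      simpa only [Set.mem_iUnion, exists_prop] using ht hk
    obtain ⟨v, hv, rfl⟩ := Set.mem_smul_set.1 hkk₀
    refine ⟨k₀, Finset.mem_image.2 ⟨k₀, hk₀t, rfl⟩, ?_⟩
    have hvK : v ∈ K := by
      have := K.mul_mem (K.inv_mem k₀.2) hk
      rwa [smul_eq_mul, inv_mul_cancel_left] at this
    exact Set.smul_mem_smul_set (hball v hvK hv)

end MatrixGroup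

/-! ### Generic elements of a connected commutative group of semisimple matrices -/

section Generic

variable {n : Type*} [Fintype n] [DecidableEq n]

/-- **Generic elements.** Let `A ≤ GL n ℂ` be a connected commutative subgroup of semisimple
elements. Then some `t ∈ A` is *generic*: every `h ∈ GL n ℂ` commuting with `t` commutes with
every element of `A`. Proof: conjugate `A` into the diagonal matrices (Springer 2.4.2), with
diagonal characters `χ₁, …, χₙ : A → ℂˣ`; for `χ_i ≠ χ_j` the closed subgroup `{χ_i = χ_j}` of
the connected group `A` is proper, hence nowhere dense (an open subgroup would be everything), so
some `t` avoids all of them; a matrix commuting with the diagonal matrix `t` has zero `(i, j)`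
entry whenever `χ_i(t) ≠ χ_j(t)`, hence commutes with all of `A` (Bröcker–tom Dieck IV (2.3)–(2.5)
for tori). [folklore] -/
theorem exists_generic_mem {A : Subgroup (GL n ℂ)} [hA : IsMulCommutative A]
    (hconn : IsConnected (A : Set (GL n ℂ))) (hss : ∀ a ∈ A, IsSemisimpleElt a) :
    ∃ t ∈ A, ∀ h : GL n ℂ, h * t = t * h → ∀ a ∈ A, h * a = a * h := by
  classical
  haveI : ConnectedSpace A := isConnected_iff_connectedSpace.1 hconn
  obtain ⟨g, hg⟩ := exists_conj_le_diagonalSubgroup (T := A) hA hss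
  -- the diagonal form of the elements of `A`
  have hdiag : ∀ a ∈ A, ∃ v : n → ℂˣ,
      ((g * a * g⁻¹ : GL n ℂ) : Matrix n n ℂ) = Matrix.diagonal fun i => (v i : ℂ) := by
    intro a ha
    obtain ⟨v, hv⟩ := hg ⟨a, ha, rfl⟩
    refine ⟨v, ?_⟩
    rw [← coe_diagonalGL, hv]
    rfl
  have hoff : ∀ a ∈ A, ∀ i j, i ≠ j → ((g * a * g⁻¹ : GL n ℂ) : Matrix n n ℂ) i j = 0 := by
    intro a ha i j hij
    obtain ⟨v, hv⟩ := hdiag a ha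
    rw [hv, Matrix.diagonal_apply_ne _ hij]
  -- the diagonal characters
  let χ : n → A → ℂ := fun i a => ((g * (a : GL n ℂ) * g⁻¹ : GL n ℂ) : Matrix n n ℂ) i i
  have hχcont : ∀ i, Continuous (χ i) := fun i =>
    (Units.continuous_val.comp ((continuous_const.mul continuous_subtype_val).mul
      continuous_const)).matrix_elem i i
  have hχone : ∀ i, χ i 1 = 1 := fun i => by simp [χ]
  have hχmul : ∀ i (a b : A), χ i (a * b) = χ i a * χ i b := by
    intro i a b
    have hab : (g * ((a * b : A) : GL n ℂ) * g⁻¹ : GL n ℂ) =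
        (g * (a : GL n ℂ) * g⁻¹) * (g * (b : GL n ℂ) * g⁻¹) := by
      rw [Subgroup.coe_mul]; group
    change ((g * ((a * b : A) : GL n ℂ) * g⁻¹ : GL n ℂ) : Matrix n n ℂ) i i =
      ((g * (a : GL n ℂ) * g⁻¹ : GL n ℂ) : Matrix n n ℂ) i i *
        ((g * (b : GL n ℂ) * g⁻¹ : GL n ℂ) : Matrix n n ℂ) i i
    rw [hab, Units.val_mul (g * (a : GL n ℂ) * g⁻¹) (g * (b : GL n ℂ) * g⁻¹), Matrix.mul_apply,
      Finset.sum_eq_single i]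
    · intro l _ hli
      rw [hoff _ b.2 l i hli, mul_zero]
    · intro hi; exact absurd (Finset.mem_univ i) hi
  have hχinv : ∀ i (a : A), χ i a⁻¹ = (χ i a)⁻¹ := by
    intro i a
    have h := hχmul i a a⁻¹
    rw [mul_inv_cancel, hχone] at h
    exact eq_inv_of_mul_eq_one_right h.symm
  -- the closed subgroups `{χ_i = χ_j}`
  let E : n × n → Subgroup A := fun p =>
    { carrier := {a | χ p.1 a = χ p.2 a}
      one_mem' := by simp only [Set.mem_setOf_eq, hχone]
      mul_mem' := fun {a b} ha hb => by
        simp only [Set.mem_setOf_eq] at ha hb ⊢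
        rw [hχmul, hχmul, ha, hb]
      inv_mem' := fun {a} ha => by
        simp only [Set.mem_setOf_eq] at ha ⊢
        rw [hχinv, hχinv, ha] }
  have hmemE : ∀ p (a : A), a ∈ E p ↔ χ p.1 a = χ p.2 a := fun p a => Iff.rfl
  have hEclosed : ∀ p, IsClosed ((E p : Subgroup A) : Set A) := fun p =>
    isClosed_eq (hχcont p.1) (hχcont p.2)
  have hEint : ∀ p : n × n, χ p.1 ≠ χ p.2 → interior ((E p : Subgroup A) : Set A) = ∅ := by
    intro p hp
    by_contra hne
    obtain ⟨x, hx⟩ := Set.nonempty_iff_ne_empty.2 hne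
    have hopen : IsOpen ((E p : Subgroup A) : Set A) :=
      (E p).isOpen_of_mem_nhds (mem_interior_iff_mem_nhds.1 hx)
    rcases isClopen_iff.1 ⟨hEclosed p, hopen⟩ with h0 | huniv
    · exact (Set.nonempty_iff_ne_empty.1 ⟨1, (E p).one_mem⟩) h0
    · exact hp (funext fun a => (hmemE p a).1
        (show a ∈ ((E p : Subgroup A) : Set A) by rw [huniv]; exact Set.mem_univ a))
  -- their finite union has empty interior
  set P : Finset (n × n) := Finset.univ.filter fun p => χ p.1 ≠ χ p.2 with hPdef
  have hunion : ∀ Q : Finset (n × n), (∀ p ∈ Q, χ p.1 ≠ χ p.2) →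
      interior (⋃ p ∈ Q, ((E p : Subgroup A) : Set A)) = ∅ := by
    intro Q
    induction Q using Finset.induction_on with
    | empty => intro; simp
    | insert q Q hq ih =>
      intro hQ
      rw [Finset.set_biUnion_insert, interior_union_isClosed_of_interior_empty (hEclosed q)
        (ih fun p hp => hQ p (Finset.mem_insert_of_mem hp))]
      exact hEint q (hQ q (Finset.mem_insert_self q Q))
  have hPint := hunion P fun p hp => (Finset.mem_filter.1 hp).2
  -- a generic element
  obtain ⟨t, ht⟩ : ∃ t : A, t ∉ ⋃ p ∈ P, ((E p : Subgroup A) : Set A) := by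
    by_contra hall
    push Not at hall
    have huniv : (⋃ p ∈ P, ((E p : Subgroup A) : Set A)) = Set.univ :=
      Set.eq_univ_of_forall hall
    rw [huniv, interior_univ] at hPint
    exact (Set.univ_nonempty (α := A)).ne_empty hPint
  refine ⟨t, t.2, fun h hht a ha => ?_⟩
  -- conjugate everything by `g`
  have hconj : ∀ x y : GL n ℂ, x * y = y * x ↔
      (g * x * g⁻¹) * (g * y * g⁻¹) = (g * y * g⁻¹) * (g * x * g⁻¹) := by
    intro x y
    constructor
    · intro hxy
      calc g * x * g⁻¹ * (g * y * g⁻¹) = g * (x * y) * g⁻¹ := by group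
        _ = g * (y * x) * g⁻¹ := by rw [hxy]
        _ = g * y * g⁻¹ * (g * x * g⁻¹) := by group
    · intro hxy
      have h1 : g * (x * y) * g⁻¹ = g * (y * x) * g⁻¹ := by
        calc g * (x * y) * g⁻¹ = g * x * g⁻¹ * (g * y * g⁻¹) := by group
          _ = g * y * g⁻¹ * (g * x * g⁻¹) := hxy
          _ = g * (y * x) * g⁻¹ := by group
      simpa using h1
  obtain ⟨vt, hvt⟩ := hdiag t t.2
  obtain ⟨va, hva⟩ := hdiag a ha
  have hvtχ : ∀ i, (vt i : ℂ) = χ i t := fun i => by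
    simp only [χ, hvt, Matrix.diagonal_apply_eq]
  have hvaχ : ∀ i, (va i : ℂ) = χ i ⟨a, ha⟩ := fun i => by
    simp only [χ, hva, Matrix.diagonal_apply_eq]
  set h' : GL n ℂ := g * h * g⁻¹ with hh'
  -- entrywise consequence of `h t = t h`
  have ht' : h' * (g * t * g⁻¹) = (g * t * g⁻¹) * h' := (hconj h t).1 hht
  have hent : ∀ i j, (h' : Matrix n n ℂ) i j * vt j = vt i * (h' : Matrix n n ℂ) i j := by
    intro i j
    have := congrArg (fun x : GL n ℂ => (x : Matrix n n ℂ) i j) ht'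
    simpa only [Units.val_mul, hvt, Matrix.mul_diagonal, Matrix.diagonal_mul] using this
  -- hence `h' (g a g⁻¹) = (g a g⁻¹) h'`
  rw [hconj]
  refine Units.ext (Matrix.ext fun i j => ?_)
  change ((h' * (g * a * g⁻¹) : GL n ℂ) : Matrix n n ℂ) i j =
    (((g * a * g⁻¹) * h' : GL n ℂ) : Matrix n n ℂ) i j
  simp only [Units.val_mul, hva, Matrix.mul_diagonal, Matrix.diagonal_mul]
  by_cases hij : χ i = χ j
  · -- equal characters: the eigenvalues of `a` agree
    have : (va i : ℂ) = va j := by rw [hvaχ, hvaχ, hij]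
    rw [this, mul_comm]
  · -- distinct characters: `t` separates them, so the entry of `h'` vanishes
    have hp : (i, j) ∈ P := Finset.mem_filter.2 ⟨Finset.mem_univ _, hij⟩
    have htE : χ i t ≠ χ j t := by
      intro heq
      exact ht (Set.mem_iUnion₂.2 ⟨(i, j), hp, (hmemE (i, j) t).2 heq⟩)
    have hzero : (h' : Matrix n n ℂ) i j = 0 := by
      have h1 := hent i j
      rw [hvtχ, hvtχ] at h1
      have h2 : (h' : Matrix n n ℂ) i j * (χ j t - χ i t) = 0 := by rw [mul_sub, h1]; ring
      rcases mul_eq_zero.1 h2 with h3 | h3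
      · exact h3
      · exact absurd (sub_eq_zero.1 h3).symm htE
    rw [hzero, zero_mul, mul_zero]

end Generic

end Literature.RepresentationTheory.CompactGroups

end
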